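import Summits.RiemannHypothesis.RiemannHypothesis.Theorems.Splittings.NbSharpFloorKernel
import HarnessLib

/-!
# Splittings / NB — the SHARP zero floor under a Nyman–Beurling distance (order `(β-1/2)¹·|ρ|⁻²`)

Cell rh-split, seat rh-split-nb-neg g3 (card `SPLIT-nb-neg.md` §9, target T1 of the g0 card,
booked by the lead as T7 `NikolskiFloor`); filed by rh-split-typer-1 g3 as the second of two files
(part 1 = `Splittings/NbSharpFloorKernel.lean`: kernel mass §1 and the regularised test function §2;
the seat's `NbSharpFloor.lean` 17e3cb5c498f7b16 split at its §2/§3 boundary for the 400-line cap,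
imports reduced to `Literature.*` + part 1 — no route file in the import cone).  Family NB:
`E_NB = (NbThesis ↔ RiemannHypothesis)`
(`Summit.RiemannHypothesis.RiemannHypothesis.Theorems.nbThesis_iff_riemannHypothesis`), integrand
`I(N,a) = ∫⁻ ‖1 - ζ(1/2+it) Σ_{k<N} a_k (k+1)^{-(1/2+it)}‖² dt/(1/4+t²)` verbatim.

The tree's `nbIntegrand_floor_of_zero` (Theorems/NymanBeurlingNbThesisZeroFloor.lean) puts, under
every distance and for every zero `ρ = β+iγ` of `ζ` with `β > 1/2`, the floor
`4π(β-1/2)² ‖ρ-1‖² / (‖ρ‖⁴ ‖ρ+1‖²)` — quadratic in `δ = β - 1/2` and of order `|γ|⁻⁴`, because the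
Cauchy kernel is bounded there by the crude `‖s-ρ‖ ≥ δ`.  This file proves the floor of the RIGHT
ORDER, linear in `δ` and of order `|γ|⁻²`, with the SAME contour inequality
(`Literature.NumberTheory.LFunctions.ofReal_norm_le_lintegral_line`) and no Hardy-space theory:

* `nbIntegrand_sharpFloorR_of_zero` — for every `R > 0`,
  `4π(β-1/2)‖ρ-1‖²/(‖ρ‖²‖ρ+1‖²) · R⁴/‖ρ+R‖⁴ ≤ I(N,a)`: test function
  `F_R(s) = (s-1-ζ₁(s)A(s)) R²/(s(s+1)(s+R)²)`, whose critical-line modulus is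
  `(‖1-ζA‖/‖s‖)·w_R(t)` with a weight `w_R ≤ 1` (a Blaschke-type factor `(s-1)/(s+1)` regularised by
  `R²/(s+R)²` to restore the decay `O(1/‖s‖)` the contour lemma wants), against the EXACT Poisson mass
  `∫ dt/‖s-ρ‖² = π/δ` (`integral_inv_sq_add_sq_le`);
* `nbIntegrand_sharpFloor_of_zero` — `R → ∞`: **`4π(β-1/2)‖ρ-1‖²/(‖ρ‖²‖ρ+1‖²) ≤ I(N,a)`** for all
  `N`, `a`; this is Nikolski's reproducing-kernel floor `4πδ/(‖ρ‖²(1+2δ/‖ρ-1‖²))`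
  [Nikolski 1995, Thm 0.1; quoted in DFMR 2013 (1.2)] up to the factor
  `(‖ρ-1‖²+2δ)/(‖ρ-1‖²+4β) ∈ (0.98, 1)` for `|γ| ≥ 14`, and it improves the tree's floor by the factor
  `‖ρ‖²/δ` (`> 390` for `|γ| ≥ 14`; `2000` at `γ = 14.13`, `δ = 0.1`);
* `treeFloor_le_sharpFloor` — the new constant dominates the old one for every `ρ` with `Re ρ > 1/2`;
* `nb_zero_constraint_of_witness_sharp`, `nb_zero_free_region_of_witness_sharp` — the CERTIFICATE
  reading (what a finite NB conjunct buys): one value `I(N,a) < η` confines the off-line zeros to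
  `4π(β-1/2)γ² < η(1+γ²)(4+γ²)`, i.e. height reach `|γ| ≲ √(4π(β-1/2)/η - 5)` — with the forced size
  `η ≳ 0.214/log N` (`lt_const_of_eventually_nbRateBound`) this is `|γ| ≤ 8.9` at `N = 10⁶`,
  `β = 0.6` (Nikolski's exact constant: `9.0`; the tree's quadratic floor: `1.2`), and `≤ 37` even at
  `N = 10¹⁰⁰`: the quantitative form of «FIN_NB is height-blind» (card §3 M3), now a kernel statement
  instead of a citation.

No definitions; RH-free; unconditional (vacuous under RH).  References: A. Beurling, Proc. Nat.
Acad. Sci. 41 (1955) 312–314 (easy half); N. Nikolski, Ann. Inst. Fourier 45 (1995) 143–159,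
Thm 0.1; C. Delaunay, E. Fricain, E. Mosaki, O. Robert, Trans. AMS 365 (2013) 3227–3253, (1.2);
J.-F. Burnol, Adv. Math. 170 (2002), Thm 1.3 (the `0.214/log N` floor used in the reach numbers).

HONEST LABEL: «SPLITTING SEARCH over kernel-typed RH-EQUIVALENCES; a splitting A ∧ B ⟹ RH is
CONDITIONAL bookkeeping unless A and B are both proved; nothing here bears on the truth of RH.»
-/

noncomputable section

-- D-0017: `Summit.<S>.<S>.…` is the designed namespace of a single-problem summit.
set_option linter.dupNamespace false

open Complex MeasureTheory Set Filter Topology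
open scoped Real ENNReal

namespace Summit.RiemannHypothesis.RiemannHypothesis.Theorems.Splittings.NbSharpFloor

open Literature.NumberTheory.LFunctions

/-! ## 3. The sharp floor -/

/-- **Sharp floor, regularised form.** If `ζ(ρ) = 0` with `Re ρ > 1/2`, then for every `R > 0` and
EVERY Dirichlet polynomial,
`4π(Re ρ-1/2)‖ρ-1‖²/(‖ρ‖²‖ρ+1‖²) · (R⁴/‖ρ+R‖⁴) ≤ ∫_ℝ |1-ζ(1/2+it)A(1/2+it)|² dt/(1/4+t²)`.
Proof: the contour inequality for `F_R` gives `2π‖F_R(ρ)‖ ≤ ∫ ‖F_R‖/‖s-ρ‖ ≤ I^{1/2}(π/δ)^{1/2}`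
(Cauchy–Schwarz, `weight_norm_le_one`, `lintegral_weightedKernel_sq_le`), and
`F_R(ρ) = (ρ-1)R²/(ρ(ρ+1)(ρ+R)²)`. [cite: Beurling1955, Theorem (easy half)]
[cite: Nikolski1995, Thm 0.1] -/
theorem nbIntegrand_sharpFloorR_of_zero {ρ : ℂ} (hζ : riemannZeta ρ = 0) (hρ : 1 / 2 < ρ.re)
    {R : ℝ} (hR : 0 < R) (N : ℕ) (a : Fin N → ℂ) :
    ENNReal.ofReal (4 * π * (ρ.re - 1 / 2) * ‖ρ - 1‖ ^ 2 / (‖ρ‖ ^ 2 * ‖ρ + 1‖ ^ 2) *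
        (R ^ 4 / ‖ρ + R‖ ^ 4)) ≤
      ∫⁻ t : ℝ, ENNReal.ofReal (‖1 - riemannZeta (1 / 2 + t * Complex.I) *
        ∑ n : Fin N, a n * ((n : ℂ) + 1) ^ (-(1 / 2 + t * Complex.I))‖ ^ 2 / (1 / 4 + t ^ 2)) := by
  -- elementary facts about `ρ`
  have hρ1 : ρ ≠ 1 := fun h ↦ riemannZeta_one_ne_zero (h ▸ hζ)
  have hρ0 : ρ ≠ 0 := by
    intro h; rw [h] at hρ; simp at hρ; linarith
  have hρm1 : ρ + 1 ≠ 0 := by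
    intro h
    have : (ρ + 1).re = 0 := by rw [h]; simp
    simp at this; linarith
  have hρR : ρ + R ≠ 0 := by
    intro h
    have : (ρ + R).re = 0 := by rw [h]; simp
    simp at this; linarith
  have hδ0 : 0 < ρ.re - 1 / 2 := by linarith
  have hn1 : 0 < ‖ρ - 1‖ := norm_pos_iff.mpr (sub_ne_zero.mpr hρ1)
  have hn0 : 0 < ‖ρ‖ := norm_pos_iff.mpr hρ0
  have hnm1 : 0 < ‖ρ + 1‖ := norm_pos_iff.mpr hρm1
  have hnR : 0 < ‖ρ + R‖ := norm_pos_iff.mpr hρR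
  -- the test function and its value at `ρ`
  set F : ℂ → ℂ := fun s : ℂ ↦ (s - 1 - riemannZeta₁ s * dirichletPoly a s) *
      ((R : ℂ) ^ 2 / ((s + 1) * (s + R) ^ 2)) / s with hF
  have hFρ : F ρ = (ρ - 1) * ((R : ℂ) ^ 2 / ((ρ + 1) * (ρ + R) ^ 2)) / ρ :=
    testR_apply_self hζ hρ1 R a
  -- the two constants
  set v : ℝ := 2 * π * ‖F ρ‖ with hv
  have hv' : v = 2 * π * (‖ρ - 1‖ * (R ^ 2 / (‖ρ + 1‖ * ‖ρ + R‖ ^ 2)) / ‖ρ‖) := by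
    rw [hv, hFρ, norm_div, norm_mul, norm_div, norm_mul, norm_pow, norm_pow, Complex.norm_real,
      Real.norm_of_nonneg hR.le]
  have hv0 : 0 < v := by rw [hv']; positivity
  set K : ℝ := π / (ρ.re - 1 / 2) with hK
  have hK0 : 0 < K := div_pos Real.pi_pos hδ0
  -- the target constant is `v² / K`
  have hc : 4 * π * (ρ.re - 1 / 2) * ‖ρ - 1‖ ^ 2 / (‖ρ‖ ^ 2 * ‖ρ + 1‖ ^ 2) *
      (R ^ 4 / ‖ρ + R‖ ^ 4) = v ^ 2 / K := by
    rw [hv', hK]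
    field_simp
    ring
  -- the integral and the kernel mass
  set Iv : ℝ≥0∞ := ∫⁻ t : ℝ, ENNReal.ofReal (‖1 - riemannZeta (1 / 2 + t * Complex.I) *
      ∑ n : Fin N, a n * ((n : ℂ) + 1) ^ (-(1 / 2 + t * Complex.I))‖ ^ 2 / (1 / 4 + t ^ 2)) with hIv
  set G : ℝ≥0∞ := ∫⁻ t : ℝ, ‖((1 / 2 : ℂ) + t * I) * (R : ℂ) ^ 2 /
        (((1 / 2 : ℂ) + t * I + 1) * ((1 / 2 : ℂ) + t * I + R) ^ 2) / (1 / 2 + t * I - ρ)‖ₑ ^ (2 : ℝ)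
    with hG
  have hGle : G ≤ ENNReal.ofReal K := lintegral_weightedKernel_sq_le hρ hR
  have hg_meas : Measurable fun t : ℝ ↦ ‖((1 / 2 : ℂ) + t * I) * (R : ℂ) ^ 2 /
        (((1 / 2 : ℂ) + t * I + 1) * ((1 / 2 : ℂ) + t * I + R) ^ 2) / (1 / 2 + t * I - ρ)‖ₑ := by
    refine Measurable.enorm ?_
    exact (by fun_prop : Measurable fun t : ℝ ↦ ((1 / 2 : ℂ) + t * I) * (R : ℂ) ^ 2 /
        (((1 / 2 : ℂ) + t * I + 1) * ((1 / 2 : ℂ) + t * I + R) ^ 2) / (1 / 2 + t * I - ρ))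
  -- Step 1: contour inequality + Cauchy–Schwarz
  have key : ENNReal.ofReal v ≤ Iv ^ (1 / 2 : ℝ) * G ^ (1 / 2 : ℝ) := by
    set M := ∑ n : Fin N, ‖a n‖ with hM
    have hM0 : 0 ≤ M := Finset.sum_nonneg fun n _ ↦ norm_nonneg _
    have hC : 0 ≤ (2 + 5 * M) * R ^ 2 := by positivity
    have hcore := ofReal_norm_le_lintegral_line (F := F) hρ (differentiableOn_testR R hR a)
      (R₀ := 1) hC (fun s hs h1 ↦ norm_testR_le hR a hs h1)
    refine hcore.trans ?_
    set f : ℝ → ℝ≥0∞ := fun t ↦ ENNReal.ofReal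
      (‖1 - riemannZeta (1 / 2 + t * I) * dirichletPoly a (1 / 2 + t * I)‖ / ‖(1 / 2 : ℂ) + t * I‖)
      with hf
    set g : ℝ → ℝ≥0∞ := fun t ↦ ‖((1 / 2 : ℂ) + t * I) * (R : ℂ) ^ 2 /
        (((1 / 2 : ℂ) + t * I + 1) * ((1 / 2 : ℂ) + t * I + R) ^ 2) / (1 / 2 + t * I - ρ)‖ₑ with hg
    have hf_meas : Measurable f := by
      refine ENNReal.measurable_ofReal.comp ?_
      refine Measurable.div ?_ (by fun_prop)
      refine (Continuous.norm ?_).measurable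
      have hc : Continuous fun t : ℝ ↦ (1 / 2 : ℂ) + t * I := by fun_prop
      exact continuous_const.sub (continuous_riemannZeta_line.mul
        ((NymanBeurlingDirichlet.continuous_dirichletPoly a).comp hc))
    calc ∫⁻ t : ℝ, ‖F (1 / 2 + t * I) / (1 / 2 + t * I - ρ)‖ₑ
        = ∫⁻ t : ℝ, (f * g) t := lintegral_congr fun t ↦ enorm_testR_div_line ρ R a t
      _ ≤ (∫⁻ t, f t ^ (2 : ℝ)) ^ (1 / (2 : ℝ)) * (∫⁻ t, g t ^ (2 : ℝ)) ^ (1 / (2 : ℝ)) :=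
          ENNReal.lintegral_mul_le_Lp_mul_Lq volume Real.HolderConjugate.two_two
            hf_meas.aemeasurable hg_meas.aemeasurable
      _ = Iv ^ (1 / 2 : ℝ) * G ^ (1 / 2 : ℝ) := by
          congr 2
          refine lintegral_congr fun t ↦ ?_
          rw [hf]
          dsimp only
          rw [ENNReal.rpow_two, ← ENNReal.ofReal_pow (by positivity), div_pow,
            norm_sq_one_half_add t]
          rfl
  -- Step 2: replace `G` by its bound and pass to real numbers
  have key2 : ENNReal.ofReal v ≤ Iv ^ (1 / 2 : ℝ) * ENNReal.ofReal (Real.sqrt K) := by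
    have hGK : G ^ (1 / 2 : ℝ) ≤ ENNReal.ofReal (Real.sqrt K) :=
      calc G ^ (1 / 2 : ℝ) ≤ (ENNReal.ofReal K) ^ (1 / 2 : ℝ) :=
            ENNReal.rpow_le_rpow hGle (by norm_num)
        _ = ENNReal.ofReal (Real.sqrt K) := by
            rw [ENNReal.ofReal_rpow_of_nonneg hK0.le (by norm_num), Real.sqrt_eq_rpow]
    calc ENNReal.ofReal v ≤ Iv ^ (1 / 2 : ℝ) * G ^ (1 / 2 : ℝ) := key
      _ ≤ Iv ^ (1 / 2 : ℝ) * ENNReal.ofReal (Real.sqrt K) := by gcongr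
  rcases eq_or_ne Iv ⊤ with htop | hfin
  · rw [htop]; exact le_top
  set i : ℝ := Iv.toReal with hi
  have hi0 : 0 ≤ i := ENNReal.toReal_nonneg
  have hIi : Iv = ENNReal.ofReal i := (ENNReal.ofReal_toReal hfin).symm
  have hreal : v ≤ Real.sqrt i * Real.sqrt K := by
    have h := key2
    rw [hIi, ENNReal.ofReal_rpow_of_nonneg hi0 (by norm_num), ← Real.sqrt_eq_rpow,
      ← ENNReal.ofReal_mul (Real.sqrt_nonneg _)] at h
    exact (ENNReal.ofReal_le_ofReal_iff (by positivity)).mp h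
  have hsq : v ^ 2 ≤ i * K := by
    have h := pow_le_pow_left₀ hv0.le hreal 2
    have e : (Real.sqrt i * Real.sqrt K) ^ 2 = i * K := by
      rw [mul_pow, Real.sq_sqrt hi0, Real.sq_sqrt hK0.le]
    exact h.trans_eq e
  rw [hc, hIi]
  refine ENNReal.ofReal_le_ofReal ?_
  rwa [div_le_iff₀ hK0]

/-- `R⁴/‖ρ+R‖⁴ → 1` as `R → ∞`. [folklore] -/
theorem tendsto_pow_four_div_norm_add (ρ : ℂ) :
    Tendsto (fun R : ℝ ↦ R ^ 4 / ‖ρ + R‖ ^ 4) atTop (𝓝 1) := by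
  have h1 : Tendsto (fun R : ℝ ↦ ‖ρ + R‖ / R) atTop (𝓝 1) := by
    have hlo : ∀ᶠ R : ℝ in atTop, 1 - ‖ρ‖ / R ≤ ‖ρ + R‖ / R := by
      filter_upwards [eventually_gt_atTop 0] with R hR
      rw [sub_le_iff_le_add, ← add_div, le_div_iff₀ hR, one_mul]
      calc R = ‖(R : ℂ)‖ := by rw [Complex.norm_real, Real.norm_of_nonneg hR.le]
        _ = ‖(ρ + R) - ρ‖ := by ring_nf
        _ ≤ ‖ρ + R‖ + ‖ρ‖ := norm_sub_le _ _
    have hhi : ∀ᶠ R : ℝ in atTop, ‖ρ + R‖ / R ≤ 1 + ‖ρ‖ / R := by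
      filter_upwards [eventually_gt_atTop 0] with R hR
      rw [div_le_iff₀ hR]
      calc ‖ρ + R‖ ≤ ‖ρ‖ + ‖(R : ℂ)‖ := norm_add_le _ _
        _ = ‖ρ‖ + R := by rw [Complex.norm_real, Real.norm_of_nonneg hR.le]
        _ = (1 + ‖ρ‖ / R) * R := by rw [add_mul, one_mul, div_mul_cancel₀ _ hR.ne', add_comm]
    have h0 : Tendsto (fun R : ℝ ↦ ‖ρ‖ / R) atTop (𝓝 0) :=
      tendsto_const_nhds.div_atTop tendsto_id
    have hlo' : Tendsto (fun R : ℝ ↦ 1 - ‖ρ‖ / R) atTop (𝓝 1) := by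
      simpa using (tendsto_const_nhds (x := (1 : ℝ))).sub h0
    have hhi' : Tendsto (fun R : ℝ ↦ 1 + ‖ρ‖ / R) atTop (𝓝 1) := by
      simpa using (tendsto_const_nhds (x := (1 : ℝ))).add h0
    exact tendsto_of_tendsto_of_tendsto_of_le_of_le' hlo' hhi' hlo hhi
  have h2 : Tendsto (fun R : ℝ ↦ (‖ρ + R‖ / R) ^ 4) atTop (𝓝 1) := by
    simpa using h1.pow 4
  have h3 : Tendsto (fun R : ℝ ↦ ((‖ρ + R‖ / R) ^ 4)⁻¹) atTop (𝓝 1) := by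
    simpa using h2.inv₀ one_ne_zero
  refine h3.congr' ?_
  filter_upwards [eventually_gt_atTop 0] with R hR
  rw [div_pow, inv_div]

/-- **SHARP ZERO FLOOR (order `(β-1/2)¹ · |ρ|⁻²`).** If `ζ(ρ) = 0` with `Re ρ > 1/2`, then for EVERY
Dirichlet polynomial `A(s) = Σ_{k<N} a_k (k+1)^{-s}`,
`4π (Re ρ - 1/2) ‖ρ-1‖² / (‖ρ‖² ‖ρ+1‖²) ≤ ∫_ℝ |1 - ζ(1/2+it) A(1/2+it)|² dt/(1/4+t²)`
(`R → ∞` in `nbIntegrand_sharpFloorR_of_zero`). Nikolski's reproducing-kernel floor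
`4πδ/(‖ρ‖²(1+2δ/‖ρ-1‖²))`, `δ = Re ρ - 1/2`, up to the factor `(‖ρ-1‖²+2δ)/(‖ρ-1‖²+4 Re ρ)`; improves
`nbIntegrand_floor_of_zero` by the factor `‖ρ‖²/δ`. Unconditional; vacuous under RH.
[cite: Beurling1955, Theorem (easy half)] [cite: Nikolski1995, Thm 0.1] -/
theorem nbIntegrand_sharpFloor_of_zero {ρ : ℂ} (hζ : riemannZeta ρ = 0) (hρ : 1 / 2 < ρ.re)
    (N : ℕ) (a : Fin N → ℂ) :
    ENNReal.ofReal (4 * π * (ρ.re - 1 / 2) * ‖ρ - 1‖ ^ 2 / (‖ρ‖ ^ 2 * ‖ρ + 1‖ ^ 2)) ≤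
      ∫⁻ t : ℝ, ENNReal.ofReal (‖1 - riemannZeta (1 / 2 + t * Complex.I) *
        ∑ n : Fin N, a n * ((n : ℂ) + 1) ^ (-(1 / 2 + t * Complex.I))‖ ^ 2 / (1 / 4 + t ^ 2)) := by
  set c : ℝ := 4 * π * (ρ.re - 1 / 2) * ‖ρ - 1‖ ^ 2 / (‖ρ‖ ^ 2 * ‖ρ + 1‖ ^ 2) with hcdef
  have hlim : Tendsto (fun R : ℝ ↦ ENNReal.ofReal (c * (R ^ 4 / ‖ρ + R‖ ^ 4))) atTop
      (𝓝 (ENNReal.ofReal c)) := by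
    refine ENNReal.tendsto_ofReal ?_
    simpa using (tendsto_pow_four_div_norm_add ρ).const_mul c
  refine le_of_tendsto hlim ?_
  filter_upwards [eventually_gt_atTop 0] with R hR
  exact nbIntegrand_sharpFloorR_of_zero hζ hρ hR N a

/-! ## 4. Comparison with the tree's floor and the certificate reading -/

/-- The sharp constant dominates the tree's `nbIntegrand_floor_of_zero` constant:
`4π δ² ‖ρ-1‖²/(‖ρ‖⁴‖ρ+1‖²) ≤ 4π δ ‖ρ-1‖²/(‖ρ‖²‖ρ+1‖²)` for `Re ρ > 1/2` (`δ = Re ρ - 1/2 ≤ ‖ρ‖²`);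
the gain factor is `‖ρ‖²/δ` (`> 390` at `|Im ρ| ≥ 14`, `δ < 1/2`). [folklore] -/
theorem treeFloor_le_sharpFloor {ρ : ℂ} (hρ : 1 / 2 < ρ.re) :
    4 * π * (ρ.re - 1 / 2) ^ 2 * ‖ρ - 1‖ ^ 2 / (‖ρ‖ ^ 4 * ‖ρ + 1‖ ^ 2) ≤
      4 * π * (ρ.re - 1 / 2) * ‖ρ - 1‖ ^ 2 / (‖ρ‖ ^ 2 * ‖ρ + 1‖ ^ 2) := by
  have hρ0 : 0 < ‖ρ‖ := by
    refine norm_pos_iff.mpr ?_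
    intro h0; rw [h0] at hρ; simp at hρ; linarith
  have hδ0 : 0 < ρ.re - 1 / 2 := by linarith
  have hδρ : ρ.re - 1 / 2 ≤ ‖ρ‖ ^ 2 := by
    rw [Complex.sq_norm, Complex.normSq_apply]
    nlinarith [sq_nonneg (ρ.re - 1 / 2), sq_nonneg ρ.im]
  rcases eq_or_ne ‖ρ + 1‖ 0 with h1 | h1
  · rw [h1]; simp
  have hρm1 : 0 < ‖ρ + 1‖ := lt_of_le_of_ne (norm_nonneg _) (Ne.symm h1)
  have hrw : 4 * π * (ρ.re - 1 / 2) ^ 2 * ‖ρ - 1‖ ^ 2 / (‖ρ‖ ^ 4 * ‖ρ + 1‖ ^ 2) =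
      4 * π * (ρ.re - 1 / 2) * ‖ρ - 1‖ ^ 2 / (‖ρ‖ ^ 2 * ‖ρ + 1‖ ^ 2) *
        ((ρ.re - 1 / 2) / ‖ρ‖ ^ 2) := by
    field_simp
  rw [hrw]
  exact mul_le_of_le_one_right (by positivity) (div_le_one_of_le₀ hδρ (by positivity))

/-- **Constraint from a witness (sharp form).** One Nyman–Beurling value `∫ |1-ζA|²/(1/4+t²) < η`
forces every zero `ρ` of `ζ` with `Re ρ > 1/2` to satisfy
`4π (Re ρ - 1/2) ‖ρ-1‖²/(‖ρ‖²‖ρ+1‖²) < η`. [cite: Beurling1955, Theorem (easy half)]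
[cite: Nikolski1995, Thm 0.1] -/
theorem nb_zero_constraint_of_witness_sharp {N : ℕ} {a : Fin N → ℂ} {η : ℝ}
    (h : ∫⁻ t : ℝ, ENNReal.ofReal (‖1 - riemannZeta (1 / 2 + t * Complex.I) *
        ∑ n : Fin N, a n * ((n : ℂ) + 1) ^ (-(1 / 2 + t * Complex.I))‖ ^ 2 / (1 / 4 + t ^ 2)) <
      ENNReal.ofReal η)
    {ρ : ℂ} (hζ : riemannZeta ρ = 0) (hρ : 1 / 2 < ρ.re) :
    4 * π * (ρ.re - 1 / 2) * ‖ρ - 1‖ ^ 2 / (‖ρ‖ ^ 2 * ‖ρ + 1‖ ^ 2) < η := by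
  have h1 := (nbIntegrand_sharpFloor_of_zero hζ hρ N a).trans_lt h
  rcases le_or_gt η 0 with hη | hη
  · rw [ENNReal.ofReal_of_nonpos hη] at h1
    exact absurd h1 ENNReal.not_lt_zero
  · exact (ENNReal.ofReal_lt_ofReal_iff hη).mp h1

/-- **Zero-free region from a witness (sharp form) — the CERTIFICATE READING of a finite NB
conjunct.** If some Dirichlet polynomial of any length achieves `∫ |1-ζA|²/(1/4+t²) < η`, then every
zero `ρ = β+iγ` of `ζ` with `β > 1/2` satisfies `4π (β-1/2) γ² < η (1+γ²)(4+γ²)`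
(`‖ρ-1‖² ≥ γ²`, `‖ρ‖² ≤ 1+γ²`, `‖ρ+1‖² ≤ 4+γ²`, using `β < 1`).  Reading: a certificate of size `η`
sees off-line zeros with `β ≥ 1/2+δ` only up to height `|γ| ≈ √(4πδ/η)`; since an achievable `η` at
length `N` is `≳ 0.214/log N` (Burnol's floor, `lt_const_of_eventually_nbRateBound`), at `N = 10⁶`,
`β = 0.6` the excluded heights are `|γ| ≤ 8.9 < γ₁ = 14.13` — FIN_NB is height-blind (card SPLIT-nb-neg
§3 M3) — versus `|γ| ≤ 1.2` from the tree's quadratic floor `nb_zero_constraint_of_witness`.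
[cite: Beurling1955, Theorem (easy half)] [cite: Nikolski1995, Thm 0.1] -/
theorem nb_zero_free_region_of_witness_sharp {N : ℕ} {a : Fin N → ℂ} {η : ℝ}
    (h : ∫⁻ t : ℝ, ENNReal.ofReal (‖1 - riemannZeta (1 / 2 + t * Complex.I) *
        ∑ n : Fin N, a n * ((n : ℂ) + 1) ^ (-(1 / 2 + t * Complex.I))‖ ^ 2 / (1 / 4 + t ^ 2)) <
      ENNReal.ofReal η)
    {ρ : ℂ} (hζ : riemannZeta ρ = 0) (hρ : 1 / 2 < ρ.re) :
    4 * π * (ρ.re - 1 / 2) * ρ.im ^ 2 < η * ((1 + ρ.im ^ 2) * (4 + ρ.im ^ 2)) := by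
  have hc := nb_zero_constraint_of_witness_sharp h hζ hρ
  have hβ1 : ρ.re < 1 := by
    by_contra hge
    exact riemannZeta_ne_zero_of_one_le_re (not_lt.mp hge) hζ
  have hδ0 : 0 < ρ.re - 1 / 2 := by linarith
  -- norms in coordinates
  have e1 : ‖ρ - 1‖ ^ 2 = (ρ.re - 1) ^ 2 + ρ.im ^ 2 := by
    rw [Complex.sq_norm, Complex.normSq_apply]; simp; ring
  have e0 : ‖ρ‖ ^ 2 = ρ.re ^ 2 + ρ.im ^ 2 := by
    rw [Complex.sq_norm, Complex.normSq_apply]; ring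
  have e2 : ‖ρ + 1‖ ^ 2 = (ρ.re + 1) ^ 2 + ρ.im ^ 2 := by
    rw [Complex.sq_norm, Complex.normSq_apply]; simp; ring
  have hden : 0 < ‖ρ‖ ^ 2 * ‖ρ + 1‖ ^ 2 := by
    rw [e0, e2]; nlinarith [sq_nonneg ρ.im, sq_nonneg (ρ.re + 1)]
  have hη : 0 < η := by
    refine lt_of_le_of_lt ?_ hc
    positivity
  have hmul : 4 * π * (ρ.re - 1 / 2) * ‖ρ - 1‖ ^ 2 < η * (‖ρ‖ ^ 2 * ‖ρ + 1‖ ^ 2) :=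
    (div_lt_iff₀ hden).mp hc
  calc 4 * π * (ρ.re - 1 / 2) * ρ.im ^ 2
      ≤ 4 * π * (ρ.re - 1 / 2) * ‖ρ - 1‖ ^ 2 := by
        rw [e1]; gcongr; nlinarith [sq_nonneg (ρ.re - 1)]
    _ < η * (‖ρ‖ ^ 2 * ‖ρ + 1‖ ^ 2) := hmul
    _ ≤ η * ((1 + ρ.im ^ 2) * (4 + ρ.im ^ 2)) := by
        rw [e0, e2]
        gcongr
        · nlinarith
        · nlinarith

end Summit.RiemannHypothesis.RiemannHypothesis.Theorems.Splittings.NbSharpFloor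

end
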